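import Literature.NumberTheory.Sieve.LinearFormsRoughTupleBound
import Literature.NumberTheory.Sieve.LinearEquationsInPrimesProofs
import Literature.NumberTheory.Sieve.BombieriAsymptoticSieveMertens
import HarnessLib

/-!
# Route `LeeYangFibres`, crux `AbsoluteUpgrade` (stmt-Parity-14116), line `nlc-cells-absolute-clip`:
# helper file 3 for the stub `stub_singlesDecay` — local densities of the product of a
# one-dimensional system and the singular product

For a system `Ψ = (ψ_k)`, `ψ_k(n) = a_k n + b_k`, of `t` affine-linear forms on `ℤ` put
`F_Ψ = ∏_k (a_k X + b_k) ∈ ℤ[X]` (`sysPoly`), so that `F_Ψ(n) = ∏_k ψ_k(n)` (`sysPoly_eval`), and let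
`ω(p) = ω_{F_Ψ}(p)` be its number of roots modulo `p` (the tree's `polyRootCountMod`).

* `rootCount_add_goodCount` — `ω(p) + g_p = p`, `g_p = goodCount Ψ p` the number of residues at which
  no form vanishes; hence (`one_sub_rootCount_div_eq`) `1 − ω(p)/p = β_p (1 − 1/p)^t` with Green–Tao's
  local factor `β_p = p⁻¹ (p/(p−1))^t g_p` (`localFactor_prime`), and
  (`prod_one_sub_rootCount_eq`) the sieve product is
  `V(z) = ∏_{p<z} (1 − ω(p)/p) = (∏_{p<z} β_p) · (∏_{p<z} (1 − 1/p))^t`, the second factor being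
  `≤ (log z)^{-t}` (Mertens, `prod_one_sub_rootCount_le`).
* `rootCount_le_of_lt` — `ω(p) ≤ t` for `p > L ≥ |a_k|` (`a_k ≠ 0`); `localFactor_ge` — for such `p`
  with `p ≥ 2t` moreover `β_p ≥ 1 − 2t²/p²` ((`p/(p−1))^t ≥ 1 + t/(p−1)`, `g_p ≥ p − t`).
* `singularProductPartial_le_two_mul_singularProduct` — **the head is at most twice the whole**:
  `∏_{p ≤ w} β_p ≤ 2 ∏_p β_p` once `w ≥ max(L, 4t²)` (the tail products are `≥ 1 − 2t² ∑_{p>w} p⁻² ≥ ½`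
  by the Weierstrass inequality, and `∏_{p ≤ x} β_p → ∏_p β_p`, Green–Tao's Lemma 1.3,
  `tendsto_singularProductPartial_holds`).
* `hasSieveDimension_sysPoly` — off the local obstructions (`ω(p) < p` for all `p`) the density
  `ω(m)/m` has sieve dimension `2(L + t)` with a constant depending on `L, t` only.

References: B. Green, T. Tao, Ann. of Math. 171 (2010), Lemma 1.3, (1.6)–(1.7) [GreenTao2010];
H. Halberstam, H.-E. Richert, *Sieve Methods* (1974), §5.7 [HalberstamRichert1974].
-/

noncomputable section

open Finset Polynomial Filter
open scoped Topology

namespace Summit.Parity.GeneralizedHardyLittlewood.Theorems.AbsoluteUpgrade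

open Literature.NumberTheory.Sieve

variable {t : ℕ}

/-! ### The product polynomial of a one-dimensional system -/

/-- `F_Ψ = ∏_k (a_k X + b_k)`, the product of the forms of a one-dimensional system as an integer
polynomial. [folklore] -/
def sysPoly (Ψ : Fin t → AffLinForm 1) : ℤ[X] :=
  ∏ k, (C ((Ψ k).coeff 0) * X + C ((Ψ k).const))

/-- `F_Ψ(n) = ∏_k ψ_k(n)`. [folklore] -/
theorem sysPoly_eval (Ψ : Fin t → AffLinForm 1) (n : ℤ) :
    (sysPoly Ψ).eval n = ∏ k, (Ψ k).eval (fun _ => n) := by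
  rw [sysPoly, RoughTuple.linProd_eval]
  exact Finset.prod_congr rfl fun k _ => by rw [DimOne.eval_eq]

/-- `F_Ψ` modulo `p` at `x` is `∏_k ψ_k(x) (mod p)`. [folklore] -/
theorem sysPoly_map_eval (Ψ : Fin t → AffLinForm 1) (p : ℕ) (x : ZMod p) :
    ((sysPoly Ψ).map (Int.castRingHom (ZMod p))).eval x = ∏ k, (Ψ k).modEval p (fun _ => x) := by
  simp only [sysPoly, Polynomial.eval_map, Polynomial.eval₂_finsetProd, Polynomial.eval₂_add,
    Polynomial.eval₂_mul, Polynomial.eval₂_C, Polynomial.eval₂_X, AffLinForm.modEval,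
    Fin.sum_univ_one]
  simp only [eq_intCast]

/-! ### Root counts versus good counts and local factors -/

/-- **`ω(p) + g_p = p`**: modulo a prime `p`, a residue is a root of `F_Ψ` iff some form vanishes
there. [cite: GreenTao2010, proof of Lemma 1.3] -/
theorem rootCount_add_goodCount (Ψ : Fin t → AffLinForm 1) {p : ℕ} (hp : p.Prime) :
    (haveI : NeZero p := ⟨hp.ne_zero⟩; polyRootCountMod ![sysPoly Ψ] p + goodCount Ψ p = p) := by
  haveI := Fact.mk hp
  have h1 : polyRootCountMod ![sysPoly Ψ] p =
      #(univ.filter fun x : ZMod p => ¬ ∀ k, ¬ (Ψ k).modEval p (fun _ => x) = 0) := by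
    rw [polyRootCountMod_single_eq_card_zmod]
    congr 1
    refine Finset.filter_congr fun x _ => ?_
    rw [sysPoly_map_eval, Finset.prod_eq_zero_iff]
    simp only [Finset.mem_univ, true_and, not_forall, not_not]
  have h2 : goodCount Ψ p = #(univ.filter fun x : ZMod p => ∀ k, ¬ (Ψ k).modEval p (fun _ => x) = 0) := by
    unfold goodCount
    refine Finset.card_nbij' (fun v => v 0) (fun x => fun _ => x) (fun v hv => ?_) (fun x hx => ?_)
      (fun v _ => ?_) (fun x _ => rfl)
    · rw [Finset.mem_coe, Finset.mem_filter] at hv ⊢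
      have hv' : (fun _ : Fin 1 => v 0) = v := funext fun j => by rw [Fin.fin_one_eq_zero j]
      rw [hv']
      exact ⟨Finset.mem_univ _, hv.2⟩
    · rw [Finset.mem_coe, Finset.mem_filter] at hx ⊢
      exact ⟨Finset.mem_univ _, hx.2⟩
    · exact funext fun j => by rw [Fin.fin_one_eq_zero j]
  rw [h1, h2, add_comm, Finset.card_filter_add_card_filter_not, Finset.card_univ,
    ZMod.card]

/-- **`1 − ω(p)/p = β_p (1 − 1/p)^t`** for every prime `p` (`β_p = p⁻¹ (p/(p−1))^t g_p`, `g_p = p − ω(p)`).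
[cite: GreenTao2010, (1.6) and proof of Lemma 1.3] -/
theorem one_sub_rootCount_div_eq (Ψ : Fin t → AffLinForm 1) {p : ℕ} (hp : p.Prime) :
    1 - (polyRootCountMod ![sysPoly Ψ] p : ℝ) / p = localFactor Ψ p * (1 - (p : ℝ)⁻¹) ^ t := by
  haveI := Fact.mk hp
  have hsum := rootCount_add_goodCount Ψ hp
  have hp0 : (p : ℝ) ≠ 0 := by exact_mod_cast hp.ne_zero
  have hp1 : (p : ℝ) - 1 ≠ 0 := by
    have : (2 : ℝ) ≤ p := by exact_mod_cast hp.two_le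
    linarith
  have hg : (goodCount Ψ p : ℝ) = p - polyRootCountMod ![sysPoly Ψ] p := by
    have h := congrArg (fun m : ℕ => (m : ℝ)) hsum
    push_cast at h
    linarith
  rw [localFactor_prime, pow_one, hg]
  have e1 : (1 - (p : ℝ)⁻¹) = (p - 1) / p := by field_simp
  have e2 : ((p : ℝ) / (p - 1)) ^ t * (((p : ℝ) - 1) / p) ^ t = 1 := by
    rw [← mul_pow, div_mul_div_comm, mul_comm ((p : ℝ) - 1), div_self (mul_ne_zero hp0 hp1),
      one_pow]
  rw [e1]
  calc 1 - (polyRootCountMod ![sysPoly Ψ] p : ℝ) / p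
      = (p : ℝ)⁻¹ * ((p : ℝ) - polyRootCountMod ![sysPoly Ψ] p) := by field_simp
    _ = (p : ℝ)⁻¹ * ((p : ℝ) - polyRootCountMod ![sysPoly Ψ] p) *
          (((p : ℝ) / (p - 1)) ^ t * (((p : ℝ) - 1) / p) ^ t) := by rw [e2, mul_one]
    _ = _ := by ring

/-- **The sieve product of `F_Ψ`**:
`∏_{p<z} (1 − ω(p)/p) = (∏_{p<z} β_p) · (∏_{p<z} (1 − 1/p))^t` (`∏_{p<z} β_p` is the tree's
`singularProductPartial Ψ (⌈z⌉₊ − 1)`). [cite: GreenTao2010, (1.6)–(1.7)] -/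
theorem prod_one_sub_rootCount_eq (Ψ : Fin t → AffLinForm 1) (z : ℝ) :
    ∏ p ∈ Nat.primesBelow ⌈z⌉₊, (1 - (polyRootCountMod ![sysPoly Ψ] p : ℝ) / p) =
      singularProductPartial Ψ (⌈z⌉₊ - 1) * (∏ p ∈ Nat.primesBelow ⌈z⌉₊, (1 - (p : ℝ)⁻¹)) ^ t := by
  rw [singularProductPartial, ← Nat.primesBelow_eq_primesLE_sub_one, ← Finset.prod_pow,
    ← Finset.prod_mul_distrib]
  exact Finset.prod_congr rfl fun p hp => one_sub_rootCount_div_eq Ψ (Nat.prime_of_mem_primesBelow hp)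

/-- `0 ≤ ∏_{p<z} (1 − 1/p) ≤ 1/log z` for `z > 1` (Mertens, tree: `BombieriSieve.prod_primesBelow_one_sub_inv_le`),
hence `∏_{p<z}(1 − ω(p)/p) ≤ (∏_{p<z} β_p) (log z)^{-t}`. [folklore] -/
theorem prod_one_sub_rootCount_le (Ψ : Fin t → AffLinForm 1) {z : ℝ} (hz : 1 < z) :
    ∏ p ∈ Nat.primesBelow ⌈z⌉₊, (1 - (polyRootCountMod ![sysPoly Ψ] p : ℝ) / p) ≤
      singularProductPartial Ψ (⌈z⌉₊ - 1) * (1 / Real.log z) ^ t := by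
  rw [prod_one_sub_rootCount_eq]
  have h0 : 0 ≤ ∏ p ∈ Nat.primesBelow ⌈z⌉₊, (1 - (p : ℝ)⁻¹) :=
    Finset.prod_nonneg fun p _ => sub_nonneg.2 (Nat.cast_inv_le_one p)
  exact mul_le_mul_of_nonneg_left
    (pow_le_pow_left₀ h0 (BombieriSieve.prod_primesBelow_one_sub_inv_le hz) t)
    (Finset.prod_nonneg fun p _ => localFactor_nonneg Ψ p)

/-! ### Root counts and local factors at the primes not dividing the coefficients -/

/-- Non-degeneracy makes every coefficient `a_k` non-zero. [cite: GreenTao2010, Def. 1.1] -/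
theorem coeff_ne_zero_of_nondegenerate {Ψ : Fin t → AffLinForm 1} (hΨ : IsNondegenerateSystem Ψ)
    (k : Fin t) : (Ψ k).coeff 0 ≠ 0 :=
  fun h0 => hΨ.1 k (funext fun j => by rw [Fin.fin_one_eq_zero j]; exact h0)

/-- For a prime `p > L ≥ |a_k|` with `a_k ≠ 0`: `p ∤ a_k`. [folklore] -/
theorem not_dvd_coeff_of_lt {Ψ : Fin t → AffLinForm 1} (hΨ : IsNondegenerateSystem Ψ) {L : ℕ}
    (haL : ∀ k, ((Ψ k).coeff 0).natAbs ≤ L) {p : ℕ} (hLp : L < p) (k : Fin t) :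
    ¬ (p : ℤ) ∣ (Ψ k).coeff 0 := fun h =>
  coeff_ne_zero_of_nondegenerate hΨ k (Int.eq_zero_of_dvd_of_natAbs_lt_natAbs h (by
    rw [Int.natAbs_natCast]; exact lt_of_le_of_lt (haL k) hLp))

/-- **`ω(p) ≤ t` for `p > L`** (each form has at most one root mod `p`). [folklore] -/
theorem rootCount_le_of_lt {Ψ : Fin t → AffLinForm 1} (hΨ : IsNondegenerateSystem Ψ) {L : ℕ}
    (haL : ∀ k, ((Ψ k).coeff 0).natAbs ≤ L) {p : ℕ} (hp : p.Prime) (hLp : L < p) :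
    polyRootCountMod ![sysPoly Ψ] p ≤ t :=
  RoughTuple.polyRootCountMod_linProd_le hp (not_dvd_coeff_of_lt hΨ haL hLp)

/-- **`β_p ≥ 1 − 2t²/p²` for `p > L`, `p ≥ 2t`**: `β_p = (p/(p−1))^t (1 − ω(p)/p)` with `ω(p) ≤ t` and
`(p/(p−1))^t = (1 + 1/(p−1))^t ≥ 1 + t/(p−1)` (Bernoulli), and
`(1 + t/(p−1))(1 − t/p) = 1 − t(t−1)/(p(p−1)) ≥ 1 − 2t²/p²`. [cite: GreenTao2010, Lemma 1.3] -/
theorem localFactor_ge {Ψ : Fin t → AffLinForm 1} (hΨ : IsNondegenerateSystem Ψ) {L : ℕ}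
    (haL : ∀ k, ((Ψ k).coeff 0).natAbs ≤ L) {p : ℕ} (hp : p.Prime) (hLp : L < p) (hpt : 2 * t ≤ p) :
    1 - 2 * (t : ℝ) ^ 2 / (p : ℝ) ^ 2 ≤ localFactor Ψ p := by
  have hω : (polyRootCountMod ![sysPoly Ψ] p : ℝ) ≤ t := by
    exact_mod_cast rootCount_le_of_lt hΨ haL hp hLp
  have hp2 : (2 : ℝ) ≤ p := by exact_mod_cast hp.two_le
  have hp0 : (0 : ℝ) < p := by linarith
  have hpt' : 2 * (t : ℝ) ≤ p := by exact_mod_cast hpt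
  have heq := one_sub_rootCount_div_eq Ψ hp
  -- `β_p (1 - 1/p)^t = 1 - ω/p ≥ 1 - t/p`
  have h1 : 1 - (t : ℝ) / p ≤ localFactor Ψ p * (1 - (p : ℝ)⁻¹) ^ t := by
    rw [← heq]
    gcongr
  -- `(1 - 1/p)^{-t} = (1 + 1/(p-1))^t ≥ 1 + t/(p-1)`
  have hq0 : 0 < 1 - (p : ℝ)⁻¹ := by
    rw [sub_pos]
    exact inv_lt_one_of_one_lt₀ (by linarith)
  have hpow0 : 0 < (1 - (p : ℝ)⁻¹) ^ t := pow_pos hq0 t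
  have hp1ne : (p : ℝ) - 1 ≠ 0 := by
    have : (0 : ℝ) < (p : ℝ) - 1 := by linarith
    exact this.ne'
  have hbern : 1 + (t : ℝ) * (1 / ((p : ℝ) - 1)) ≤ ((1 - (p : ℝ)⁻¹) ^ t)⁻¹ := by
    have e1' : (1 - (p : ℝ)⁻¹) = (p - 1) / p := by field_simp
    have e : ((1 - (p : ℝ)⁻¹) ^ t)⁻¹ = (1 + 1 / ((p : ℝ) - 1)) ^ t := by
      rw [← inv_pow, e1', inv_div, one_add_div hp1ne, sub_add_cancel]
    rw [e]
    exact one_add_mul_le_pow (by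
      have : (0 : ℝ) ≤ 1 / ((p : ℝ) - 1) := by
        have : (0 : ℝ) < (p : ℝ) - 1 := by linarith
        positivity
      linarith) t
  -- combine: `β_p ≥ (1 - t/p) (1 - 1/p)^{-t} ≥ (1 - t/p)(1 + t/(p-1))`
  have ht0 : 0 ≤ 1 - (t : ℝ) / p := by
    rw [sub_nonneg, div_le_one hp0]
    linarith [show (0 : ℝ) ≤ t from Nat.cast_nonneg t]
  have h2 : (1 - (t : ℝ) / p) * ((1 - (p : ℝ)⁻¹) ^ t)⁻¹ ≤ localFactor Ψ p := by
    have := mul_le_mul_of_nonneg_right h1 (inv_nonneg.mpr hpow0.le)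
    rwa [mul_assoc, mul_inv_cancel₀ hpow0.ne', mul_one] at this
  have h3 : (1 - (t : ℝ) / p) * (1 + (t : ℝ) * (1 / ((p : ℝ) - 1))) ≤ localFactor Ψ p :=
    (mul_le_mul_of_nonneg_left hbern ht0).trans h2
  -- `(1 - t/p)(1 + t/(p-1)) = 1 - t(t-1)/(p(p-1)) ≥ 1 - 2t²/p²`
  have hp1 : (0 : ℝ) < (p : ℝ) - 1 := by linarith
  have h4 : 1 - 2 * (t : ℝ) ^ 2 / (p : ℝ) ^ 2 ≤
      (1 - (t : ℝ) / p) * (1 + (t : ℝ) * (1 / ((p : ℝ) - 1))) := by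
    have eR : (1 - (t : ℝ) / p) * (1 + (t : ℝ) * (1 / ((p : ℝ) - 1))) =
        1 - ((t : ℝ) ^ 2 - t) / (p * (p - 1)) := by
      field_simp
      ring
    rw [eR]
    have h5 : ((t : ℝ) ^ 2 - t) / (p * (p - 1)) ≤ 2 * (t : ℝ) ^ 2 / (p : ℝ) ^ 2 := by
      rw [div_le_div_iff₀ (mul_pos hp0 hp1) (by positivity)]
      nlinarith [mul_nonneg (mul_nonneg (sq_nonneg (t : ℝ)) hp0.le) (by linarith : (0 : ℝ) ≤ p - 2),
        mul_nonneg (Nat.cast_nonneg t) (sq_nonneg (p : ℝ))]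
    linarith
  exact h4.trans h3

/-! ### The head of the singular product is at most twice the whole -/

/-- **Tail products are at least `½`**: for `w ≥ max(L, 4t²)` and `x ≥ w`,
`∏_{w < p ≤ x} β_p ≥ 1 − 2t² ∑_{p > w} p⁻² ≥ ½` (Weierstrass' inequality, tree:
`APSystem.prod_ge_one_sub_sum`; `∑_{n>w} n⁻² ≤ 1/w`). [cite: GreenTao2010, Lemma 1.3] -/
theorem half_le_prod_tail_localFactor {Ψ : Fin t → AffLinForm 1} (hΨ : IsNondegenerateSystem Ψ)
    {L : ℕ} (haL : ∀ k, ((Ψ k).coeff 0).natAbs ≤ L) {w : ℕ} (x : ℕ) (hwL : L ≤ w)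
    (hwt : 4 * t ^ 2 ≤ w) (hw1 : 1 ≤ w) :
    (1 : ℝ) / 2 ≤ ∏ p ∈ Nat.primesLE x \ Nat.primesLE w, localFactor Ψ p := by
  have hmem : ∀ p ∈ Nat.primesLE x \ Nat.primesLE w, p.Prime ∧ w < p ∧ p ≤ x := by
    intro p hp
    obtain ⟨hp1, hp2⟩ := Finset.mem_sdiff.mp hp
    rw [Nat.mem_primesLE] at hp1 hp2
    exact ⟨hp1.2, by by_contra hh; exact hp2 ⟨by omega, hp1.2⟩, hp1.1⟩
  have hlow := Literature.Barriers.Parity.APSystem.prod_ge_one_sub_sum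
    (Nat.primesLE x \ Nat.primesLE w) (fun p => localFactor Ψ p)
    (fun p => 2 * (t : ℝ) ^ 2 / (p : ℝ) ^ 2) (fun p _ => localFactor_nonneg Ψ p)
    (fun p _ => by positivity) (fun p hp => by
      obtain ⟨hpp, hwp, -⟩ := hmem p hp
      refine localFactor_ge hΨ haL hpp (by omega) ?_
      -- `2t ≤ 4t² ≤ w < p` (or `t = 0`)
      rcases Nat.eq_zero_or_pos t with h0 | h0
      · omega
      · nlinarith)
  refine le_trans ?_ hlow
  have hsum : ∑ p ∈ Nat.primesLE x \ Nat.primesLE w, 2 * (t : ℝ) ^ 2 / (p : ℝ) ^ 2 ≤ 1 / 2 := by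
    calc ∑ p ∈ Nat.primesLE x \ Nat.primesLE w, 2 * (t : ℝ) ^ 2 / (p : ℝ) ^ 2
        ≤ ∑ n ∈ Finset.Ioc w x, 2 * (t : ℝ) ^ 2 / (n : ℝ) ^ 2 := by
          refine Finset.sum_le_sum_of_subset_of_nonneg (fun p hp => ?_) (fun n _ _ => by positivity)
          obtain ⟨-, hwp, hpx⟩ := hmem p hp
          exact Finset.mem_Ioc.mpr ⟨hwp, hpx⟩
      _ = 2 * (t : ℝ) ^ 2 * ∑ n ∈ Finset.Ioc w x, ((n : ℝ) ^ 2)⁻¹ := by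
          rw [Finset.mul_sum]
          exact Finset.sum_congr rfl fun n _ => by rw [div_eq_mul_inv]
      _ ≤ 2 * (t : ℝ) ^ 2 * (w : ℝ)⁻¹ := by
          gcongr
          exact sum_Ioc_inv_sq_le hw1 x
      _ ≤ 1 / 2 := by
          have hw0 : (0 : ℝ) < w := by exact_mod_cast hw1
          have hwt' : 4 * (t : ℝ) ^ 2 ≤ w := by exact_mod_cast hwt
          rw [← div_eq_mul_inv, div_le_iff₀ hw0]
          linarith
  linarith

/-- **The head of the singular product is at most twice the whole**: for a non-degenerate system with
`|a_k| ≤ L` and `w ≥ max(L, 4t², 1)`, `∏_{p ≤ w} β_p ≤ 2 ∏_p β_p` (`∏_{p ≤ x} β_p = ∏_{p ≤ w} β_p ·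
∏_{w<p≤x} β_p ≥ ½ ∏_{p ≤ w} β_p` for all `x ≥ w`, and `∏_{p ≤ x} β_p → ∏_p β_p`, Lemma 1.3).
[cite: GreenTao2010, Lemma 1.3 and (1.7)] -/
theorem singularProductPartial_le_two_mul_singularProduct : ∀ {t : ℕ} {Ψ : Fin t → AffLinForm 1}, IsNondegenerateSystem Ψ → ∀ {L : ℕ}, (∀ k, ((Ψ k).coeff 0).natAbs ≤ L) → ∀ {w : ℕ}, L ≤ w → 4 * t ^ 2 ≤ w → 1 ≤ w → singularProductPartial Ψ w ≤ 2 * singularProduct Ψ := by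
  intro t Ψ hΨ L haL w hwL hwt hw1
  have hT := tendsto_singularProductPartial_holds 1 t Ψ hΨ
  have hhead0 : 0 ≤ singularProductPartial Ψ w := Finset.prod_nonneg fun p _ => localFactor_nonneg Ψ p
  have hev : ∀ᶠ x in atTop, singularProductPartial Ψ w / 2 ≤ singularProductPartial Ψ x := by
    refine Filter.eventually_atTop.mpr ⟨w, fun x hwx => ?_⟩
    have hsplit : singularProductPartial Ψ x =
        singularProductPartial Ψ w * ∏ p ∈ Nat.primesLE x \ Nat.primesLE w, localFactor Ψ p := by
      unfold singularProductPartial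
      rw [mul_comm, Finset.prod_sdiff (Nat.primesLE_mono hwx)]
    rw [hsplit]
    have h := half_le_prod_tail_localFactor hΨ haL x hwL hwt hw1
    calc singularProductPartial Ψ w / 2 = singularProductPartial Ψ w * (1 / 2) := by ring
      _ ≤ _ := mul_le_mul_of_nonneg_left h hhead0
  have := ge_of_tendsto hT hev
  linarith

/-! ### Sieve dimension off the local obstructions -/

/-- **`ω(p) ≤ L + t` for every prime** (trivially `ω(p) ≤ p ≤ L` for `p ≤ L`). [folklore] -/
theorem rootCount_le_add {Ψ : Fin t → AffLinForm 1} (hΨ : IsNondegenerateSystem Ψ) {L : ℕ}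
    (haL : ∀ k, ((Ψ k).coeff 0).natAbs ≤ L) {p : ℕ} (hp : p.Prime) :
    polyRootCountMod ![sysPoly Ψ] p ≤ L + t := by
  by_cases hLp : L < p
  · exact (rootCount_le_of_lt hΨ haL hp hLp).trans (Nat.le_add_left _ _)
  · push Not at hLp
    exact ((polyRootCountMod_le _ p).trans hLp).trans (Nat.le_add_right _ _)

/-- **Off the local obstructions the root density of `F_Ψ` has sieve dimension `2(L + t)`** with a
constant depending on `L, t` only (tree: `PolyPrimeCountBrun.hasSieveDimension_rootDensity_of_le`).
[folklore] -/
theorem hasSieveDimension_sysPoly {Ψ : Fin t → AffLinForm 1} (hΨ : IsNondegenerateSystem Ψ) {L : ℕ}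
    (haL : ∀ k, ((Ψ k).coeff 0).natAbs ≤ L)
    (hlt : ∀ p : ℕ, p.Prime → polyRootCountMod ![sysPoly Ψ] p < p) :
    HasSieveDimension (rootDensity (sysPoly Ψ)) (2 * ((L + t : ℕ) : ℝ))
      (((2 * (L + t) + 1 : ℕ) : ℝ) ^ (2 * (L + t) + 1) *
        Real.exp (2 * ((L + t : ℕ) : ℝ) * (9 / 2 + 6 / Real.log 2))) :=
  PolyPrimeCountBrun.hasSieveDimension_rootDensity_of_le (fun _ hp => rootCount_le_add hΨ haL hp) hlt

end Summit.Parity.GeneralizedHardyLittlewood.Theorems.AbsoluteUpgrade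

end
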